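import Mathlib
import HarnessLib
import Summits.NavierStokesRegularity.NavierStokesRegularity.Theorems.PoloidalWindowDoorPoloidalWindowRigiditySlopeFunctionPressure
import Summits.NavierStokesRegularity.NavierStokesRegularity.Theorems.PoloidalWindowDoorPoloidalWindowRigidityDegenerate

/-!
# Route `PoloidalWindowDoor`, crux `PoloidalWindowRigidity` (K2, stmt-NavierStokesRegularity-19708) — the stratum (SF)
# «SHEAR SLOPE A FUNCTION OF TIME AND VERTICAL VELOCITY», III: the height-free sub-stratum is EMPTY

Cell ns-regularity-ideate, seat ns-poloidal-K2-p2 gen 4 (stub-worker on crux K2; file landed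
`--supports stmt-NavierStokesRegularity-19708` as a helper).  Third part, after `…SlopeFunctionPressure` / `…SlopeFunctionSource` (the stratum (SF):
`∂₂v_b = ∂_sG(t,v₂) ∂_b v₂`, `b = 0,1`, for one slope antiderivative `G : ℝ → ℝ → ℝ`; its pressure law
`slopeFunction_pressure`).  WHAT THIS IS NOT: not a claim about Navier–Stokes regularity, not the registered stub
`stub_lrcModEntire` — one more located sub-stratum of the crux's generic residue emptied, and the residual of (SF) located
(bears_on LADDER-NS N0 via crux K2 = stmt-19708).

Part I gives, for the CLEBSCH WEIGHT `u := v₂ − G(t,v₂)`, `𝓛u = (1 − ∂_sG)f₂ − ∂ₜG + ∂_s²G·Σᵢ(∂ᵢv₂)²` and `∇_h u = J ω_h`;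
part II (`…SlopeFunctionSource`) shows `∇_h 𝓛u = 0` on (SF): the Clebsch weight is a passive scalar with a source `a(t,x₂)`.
* `eq_zero_of_slopeFunction_passive` / `nonflatLiouville_of_slopeFunction_passive` — **(SF) ∩ {height-free source} IS
  EMPTY in the class**: if `a = a(t)` and the slope is bounded along the profile (`|∂_sG(t,v₂)| ≤ M`), then `u` has slope
  `≤ (1+M)C₁/(−t)` (class gradient rate `…ClassRate`) and a time-only source, so nsreg-p7's ancient decaying-slope
  Liouville lemma (`…DecayingSlopeLiouville.stub_decayingSlopeLiouville`) makes `u` slice-constant, whence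
  `ω_h = J∇_h u = 0`, `curl v ≡ 0`, and `v ≡ 0` (`…Degenerate.eq_zero_of_irrotational`).  In (TV) the height-freeness is
  DERIVED (M12 variance decay + tested vertical momentum, p524146/p524699/p525351, where `Λ_u ≡ 0`); for a general slope
  function it is THE LOCATED RESIDUAL of (SF): the horizontal-variance law of `u` at scale `R` has zero source covariance
  (height-only source) and exact dissipation, but a PRODUCTION term `−2∂₂⟨u⟩·⟨v₂′u′⟩` with
  `∂₂⟨u⟩ = −⟨(Λ(u) − Λ(⟨u⟩))∂₂u′⟩/⟨Λ⟩ + O(1/R)` (`Λ = 1/(1−m)` as a function of `u`), which is critical (log-divergent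
  Grönwall) under scale-invariant bounds and vanishes iff `Λ_u ≡ 0`, i.e. exactly on (TV) (seat note SF-NEXT.md, evidence
  on the crux item; a perturbative closure `Λ_u` small is recorded there).
-/

noncomputable section

-- the summit and its single sub-problem share the name (CONVENTIONS §1), as in every Theorems file
set_option linter.dupNamespace false

namespace Summit.NavierStokesRegularity.NavierStokesRegularity.Theorems.PoloidalWindowDoorPoloidalWindowRigiditySlopeFunctionPassive

open MeasureTheory Set Function Filter Topology TopologicalSpace Metric InnerProductSpace
open scoped RealInnerProductSpace InnerProductSpace Laplacian ContDiff
open Literature.Analysis Literature.Analysis.FluidPDE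
open Summit.NavierStokesRegularity.NavierStokesRegularity.Theorems.LocalSineTubeDoorProfileAlignedWindowRigidityAncient
open Summit.NavierStokesRegularity.NavierStokesRegularity.Theorems.PoloidalWindowDoorPoloidalWindowRigidityWindow
open Summit.NavierStokesRegularity.NavierStokesRegularity.Theorems.PoloidalWindowDoorPoloidalWindowRigidityFlat
open Summit.NavierStokesRegularity.NavierStokesRegularity.Theorems.PoloidalWindowDoorPoloidalWindowRigidityVelocityGradientLaw
open Summit.NavierStokesRegularity.NavierStokesRegularity.Theorems.PoloidalWindowDoorPoloidalWindowRigiditySeparatedPressure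
open Summit.NavierStokesRegularity.NavierStokesRegularity.Theorems.PoloidalWindowDoorPoloidalWindowRigidityMaterialLeibniz
open Summit.NavierStokesRegularity.NavierStokesRegularity.Theorems.PoloidalWindowDoorPoloidalWindowRigidityVerticalSourceGauge
open Summit.NavierStokesRegularity.NavierStokesRegularity.Theorems.PoloidalWindowDoorPoloidalWindowRigidityDecayingSlopeLiouville
open Summit.NavierStokesRegularity.NavierStokesRegularity.Theorems.PoloidalWindowDoorPoloidalWindowRigidityClassRate
open Summit.NavierStokesRegularity.NavierStokesRegularity.Theorems.PoloidalWindowDoorPoloidalWindowRigidityDegenerate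
open Summit.NavierStokesRegularity.NavierStokesRegularity.Theorems.PoloidalWindowDoorPoloidalWindowRigiditySlopeFunctionPressure

variable {C : ℝ} {v : ℝ → EuclideanSpace ℝ (Fin 3) → EuclideanSpace ℝ (Fin 3)}

section Class

variable (hrate : HasTypeITimeDecay C v) (hcont : ContinuousOn (uncurry v) (Iio (0 : ℝ) ×ˢ univ))
  (hmild : ∀ s t : ℝ, s < t → t < 0 → ∀ x,
    v t x = UnboundedOperators.heatExtension (v s) (t - s) x - oseenDuhamel 1 s v v t x)
  (hdiv : ∀ t < 0, VectorCalculus.IsDivFree (v t))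

include hrate hcont hmild hdiv

/-! ### (SF) with a height-free source is empty -/

/-- **(SF) ∩ {PASSIVE CLEBSCH WEIGHT} IS EMPTY IN THE CLASS.**  Let `v` be a profile of the route's Type-I class,
poloidal along `e₃`, on the stratum (SF) with slope antiderivative `G ∈ C²(ℝ²)` (`∂₂v_b = ∂_sG(t,v₂)∂_bv₂`, `b = 0,1`),
slope bounded along the profile (`|∂_sG(t,v₂(t,y))| ≤ M`), and suppose the material source of the Clebsch weight
`u = v₂ − G(t,v₂)` — `(1 − ∂_sG)f₂ − ∂ₜG + ∂_s²G·‖∇v₂‖²`, horizontally constant by `slopeFunction_pressure` — depends on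
time only.  Then `v ≡ 0`: `u` obeys the ancient decaying-slope Liouville lemma (slope `(1+M)C₁/(−t)`, time-only source),
so it is slice-constant, `ω_h = J∇_hu = 0`, `curl v ≡ 0`, and the irrotational stratum is empty. -/
theorem eq_zero_of_slopeFunction_passive
    (hpol : ∀ s < 0, ∀ y, ⟪curl (v s) y, EuclideanSpace.single 2 1⟫_ℝ = 0) {G : ℝ → ℝ → ℝ}
    (hG : ContDiff ℝ 2 (uncurry G))
    (hslope : ∀ s < 0, ∀ y, ∀ b : Fin 3, b ≠ 2 →
      fderiv ℝ (v s) y (EuclideanSpace.single 2 1) b =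
        deriv (G s) (v s y 2) * fderiv ℝ (v s) y (EuclideanSpace.single b 1) 2)
    {M : ℝ} (hM : ∀ s < 0, ∀ y, |deriv (G s) (v s y 2)| ≤ M) {a : ℝ → ℝ}
    (hpass : ∀ t < 0, ∀ x,
      (1 - deriv (G t) (v t x 2)) * (timeDerivWithin (Iio 0) v t x + convect (v t) (v t) x - Δ (v t) x) 2
        - deriv (fun τ => G τ (v t x 2)) t
        + deriv (deriv (G t)) (v t x 2) * ∑ i : Fin 3, fderiv ℝ (v t) x (EuclideanSpace.single i 1) 2 ^ 2 = a t) :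
    ∀ t < 0, ∀ x, v t x = 0 := by
  have hA : IsTypeIAncientMild C v := isTypeIAncientMild_of_class hrate hcont hmild hdiv
  obtain ⟨C₁, hC₁⟩ := exists_fderiv_rate_of_class hrate hcont hmild
  -- the Clebsch weight as an opaque scalar field
  obtain ⟨u, hu⟩ : ∃ u : ℝ → EuclideanSpace ℝ (Fin 3) → ℝ, ∀ s y, u s y = v s y 2 - G s (v s y 2) :=
    ⟨_, fun _ _ => rfl⟩
  have hufun : ∀ s, u s = fun y => v s y 2 - G s (v s y 2) := fun s => funext (hu s)
  have hM0 : 0 ≤ M := (abs_nonneg _).trans (hM (-1) (by norm_num) 0)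
  have hC₁0 : 0 ≤ C₁ := by
    have h := hC₁ (-1) (by norm_num) 0
    rw [neg_neg, div_one] at h
    exact (norm_nonneg _).trans h
  -- ## (1) joint `C²` regularity of `u` on the slab
  have hsm : ContDiffOn ℝ ∞ (uncurry v) (Iio (0 : ℝ) ×ˢ univ) :=
    (analyticOnNhd_uncurry hcont (bdd_of_hasTypeITimeDecay hrate) hmild).contDiffOn_of_completeSpace
  have hureg : ContDiffOn ℝ 2 (uncurry u) (Iio (0 : ℝ) ×ˢ univ) := by
    have h1 : ContDiffOn ℝ 2 (fun p : ℝ × EuclideanSpace ℝ (Fin 3) => (uncurry v p) 2) (Iio (0 : ℝ) ×ˢ univ) :=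
      (EuclideanSpace.proj (𝕜 := ℝ) (2 : Fin 3) : EuclideanSpace ℝ (Fin 3) →L[ℝ] ℝ).contDiff.comp_contDiffOn
        (hsm.of_le (by norm_cast))
    have h2 : ContDiffOn ℝ 2 (fun p : ℝ × EuclideanSpace ℝ (Fin 3) => G p.1 ((uncurry v p) 2))
        (Iio (0 : ℝ) ×ˢ univ) :=
      hG.comp_contDiffOn (contDiffOn_fst.prodMk h1)
    refine (h1.sub h2).congr fun p _ => ?_
    rcases p with ⟨s, y⟩
    simp [hu]
  -- ## (2) the material equation of `u`: source `a(t)`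
  have heq : ∀ t < 0, ∀ x, deriv (fun τ => u τ x) t + fderiv ℝ (u t) x (v t x) - Δ (u t) x = a t := by
    intro t ht x
    have e1 : (fun τ => u τ x) = fun τ => v τ x 2 - G τ (v τ x 2) := funext fun τ => hu τ x
    rw [e1, hufun t, material_clebschWeight hrate hcont hmild hdiv hG ht x]
    exact hpass t ht x
  -- ## (3) the slope of `u`: `‖∇u‖ ≤ (1+M) C₁/(−t)`
  have hDu : ∀ t < 0, ∀ y, ‖fderiv ℝ (u t) y‖ ≤ (1 + M) * (C₁ / (-t)) := by
    intro t ht y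
    have hsd : Differentiable ℝ (v t) := (hA.contDiff_slice ht).differentiable (by simp)
    rw [hufun t, (hasFDerivAt_clebschWeight hrate hcont hmild hdiv hG ht y).fderiv, norm_smul]
    have h1 : ‖(1 : ℝ) - deriv (G t) (v t y 2)‖ ≤ 1 + M := by
      rw [Real.norm_eq_abs]
      calc |1 - deriv (G t) (v t y 2)| ≤ |(1 : ℝ)| + |deriv (G t) (v t y 2)| := abs_sub _ _
        _ ≤ 1 + M := by rw [abs_one]; linarith [hM t ht y]
    have h2 : ‖fderiv ℝ (fun z => v t z 2) y‖ ≤ C₁ / (-t) := by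
      refine ContinuousLinearMap.opNorm_le_bound _ ((norm_nonneg _).trans (hC₁ t ht y)) fun w => ?_
      rw [FluidPDE.fderiv_apply_coord (hsd y), Real.norm_eq_abs]
      calc |fderiv ℝ (v t) y w 2| ≤ ‖fderiv ℝ (v t) y w‖ := by
            simpa [Real.norm_eq_abs] using PiLp.norm_apply_le (fderiv ℝ (v t) y w) 2
        _ ≤ ‖fderiv ℝ (v t) y‖ * ‖w‖ := ContinuousLinearMap.le_opNorm _ _
        _ ≤ C₁ / (-t) * ‖w‖ := mul_le_mul_of_nonneg_right (hC₁ t ht y) (norm_nonneg _)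
    exact mul_le_mul h1 h2 (norm_nonneg _) (by linarith)
  have hslope_u : ∀ t < 0, ∀ x, |u t x - u t 0| ≤ (1 + M) * (C₁ / (-t)) * ‖x - 0‖ := by
    intro t ht x
    have hdiff : ∀ y ∈ (univ : Set (EuclideanSpace ℝ (Fin 3))), DifferentiableAt ℝ (u t) y := by
      intro y _
      rw [hufun t]
      exact (hasFDerivAt_clebschWeight hrate hcont hmild hdiv hG ht y).differentiableAt
    have h := Convex.norm_image_sub_le_of_norm_fderiv_le hdiff (fun y _ => hDu t ht y) convex_univ
      (mem_univ 0) (mem_univ x)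
    rwa [Real.norm_eq_abs] at h
  -- ## (4) the clock of the slope: continuity and `ε(t)√(−t) → 0`
  have hεc : ContinuousOn (fun t : ℝ => (1 + M) * (C₁ / (-t))) (Iio 0) :=
    continuousOn_const.mul (continuousOn_const.div continuousOn_id.neg fun t ht => by
      simp only [mem_Iio] at ht; exact neg_ne_zero.2 ht.ne)
  have hεt : Tendsto (fun t : ℝ => (1 + M) * (C₁ / (-t)) * Real.sqrt (-t)) atBot (𝓝 0) := by
    have h1 : Tendsto (fun t : ℝ => -t) atBot atTop := tendsto_neg_atBot_atTop
    have h2 : Tendsto (fun s : ℝ => (Real.sqrt s)⁻¹) atTop (𝓝 0) := Real.tendsto_sqrt_atTop.inv_tendsto_atTop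
    have h3 : Tendsto (fun t : ℝ => (Real.sqrt (-t))⁻¹) atBot (𝓝 0) := h2.comp h1
    have h4 : Tendsto (fun t : ℝ => (1 + M) * C₁ * (Real.sqrt (-t))⁻¹) atBot (𝓝 0) := by
      simpa using h3.const_mul ((1 + M) * C₁)
    refine h4.congr' ?_
    filter_upwards [Iio_mem_atBot (0 : ℝ)] with t ht
    have hnt : 0 < -t := neg_pos.2 ht
    have hs : Real.sqrt (-t) ≠ 0 := (Real.sqrt_pos.2 hnt).ne'
    have hst : Real.sqrt (-t) * Real.sqrt (-t) = -t := Real.mul_self_sqrt hnt.le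
    generalize Real.sqrt (-t) = σ at hs hst ⊢
    rw [← hst]
    field_simp
  -- ## (5) the ancient decaying-slope Liouville lemma: `u` is slice-constant
  have hconst := stub_decayingSlopeLiouville C v hrate hcont hmild hdiv u a 0 (fun t => (1 + M) * (C₁ / (-t)))
    hureg heq hslope_u hεc hεt
  -- ## (6) hence `curl v ≡ 0` and the irrotational stratum is empty
  have hirr : ∀ s < 0, ∀ y, curl (v s) y = 0 := by
    intro s hs y
    have hfd : fderiv ℝ (u s) y = 0 := by
      have e : u s = fun _ => u s 0 := funext fun z => hconst s hs z
      rw [e]; simp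
    have hsd : Differentiable ℝ (v s) := (hA.contDiff_slice hs).differentiable (by simp)
    have hD := (hasFDerivAt_clebschWeight hrate hcont hmild hdiv hG hs y).fderiv
    rw [← hufun s, hfd] at hD
    have hcomp : ∀ w, (1 - deriv (G s) (v s y 2)) * fderiv ℝ (v s) y w 2 = 0 := by
      intro w
      have h := congrArg (fun L : EuclideanSpace ℝ (Fin 3) →L[ℝ] ℝ => L w) hD
      simp only [FunLike.coe_smul, Pi.smul_apply, smul_eq_mul] at h
      rw [FluidPDE.fderiv_apply_coord (hsd y)] at h
      exact h.symm
    obtain ⟨hc0, hc1, hc2⟩ := curl_eq_of_slopeFunction hpol hs hslope y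
    ext i
    fin_cases i
    · simpa [hcomp (EuclideanSpace.single 1 1)] using hc0
    · simpa [hcomp (EuclideanSpace.single 0 1)] using hc1
    · simpa using hc2
  exact eq_zero_of_irrotational hrate hcont hmild hdiv hirr

/-- **(SF) with a passive Clebsch weight, in the currency of the crux**: such a profile is not backward-singular
at the apex. -/
theorem nonflatLiouville_of_slopeFunction_passive
    (hpol : ∀ s < 0, ∀ y, ⟪curl (v s) y, EuclideanSpace.single 2 1⟫_ℝ = 0) {G : ℝ → ℝ → ℝ}
    (hG : ContDiff ℝ 2 (uncurry G))
    (hslope : ∀ s < 0, ∀ y, ∀ b : Fin 3, b ≠ 2 →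
      fderiv ℝ (v s) y (EuclideanSpace.single 2 1) b =
        deriv (G s) (v s y 2) * fderiv ℝ (v s) y (EuclideanSpace.single b 1) 2)
    {M : ℝ} (hM : ∀ s < 0, ∀ y, |deriv (G s) (v s y 2)| ≤ M) {a : ℝ → ℝ}
    (hpass : ∀ t < 0, ∀ x,
      (1 - deriv (G t) (v t x 2)) * (timeDerivWithin (Iio 0) v t x + convect (v t) (v t) x - Δ (v t) x) 2
        - deriv (fun τ => G τ (v t x 2)) t
        + deriv (deriv (G t)) (v t x 2) * ∑ i : Fin 3, fderiv ℝ (v t) x (EuclideanSpace.single i 1) 2 ^ 2 = a t) :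
    ¬ IsBackwardSingularPoint v 0 := by
  have hirr : ∀ s < 0, ∀ y, curl (v s) y = 0 := by
    intro s hs y
    have hA : IsTypeIAncientMild C v := isTypeIAncientMild_of_class hrate hcont hmild hdiv
    have hz := eq_zero_of_slopeFunction_passive hrate hcont hmild hdiv hpol hG hslope hM hpass
    have e : v s = fun _ => 0 := funext fun y => hz s hs y
    simp [curl, e]
  exact nonflatLiouville_of_irrotational hrate hcont hmild hdiv hirr

end Class

end Summit.NavierStokesRegularity.NavierStokesRegularity.Theorems.PoloidalWindowDoorPoloidalWindowRigiditySlopeFunctionPassive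

end
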